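import Summits.BirchSwinnertonDyer.BirchSwinnertonDyer.Theorems.ByReductionTypeAtTwoSupersingularFlatCountTwoOfPrint
import Summits.BirchSwinnertonDyer.BirchSwinnertonDyer.Theorems.ByReductionTypeAtTwoSupersingularFlatLocalLiftAway
import Summits.BirchSwinnertonDyer.BirchSwinnertonDyer.Theorems.ThetaPartnerAtTwoSignedControlAtTwoCoinvOfResTwo
import Summits.BirchSwinnertonDyer.BirchSwinnertonDyer.Theorems.ThetaPartnerAtTwoSignedControlAtTwoDivOfShaTwoAnyField
import Summits.BirchSwinnertonDyer.BirchSwinnertonDyer.Theorems.ThetaPartnerAtTwoSignedControlAtTwoShaTwoPrimaryVanishing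
import Literature.NumberTheory.EllipticCurves.Greenberg1999.LocalQuotientControlSurjectiveProofs
import HarnessLib

/-!
# COUNT♭@2 from CASSELS and `Ш²(ℚ, E[2^∞]) = 0` — Greenberg's Prop. 4.12, the corank count, weak Leopoldt and
# the dual datum of `H¹(ℚ_Σ/ℚ_∞, E[2^∞])` ALL LEAVE the COUNT♭@2 door of `SupersingularRankZeroAtTwo`
# (item stmt-BirchSwinnertonDyer-19097, route `ByReductionTypeAtTwo`, line `flat_uniform_two`; written by the K4-inputs seat)

Seat `bsd-inputs-k4-p1` (ASIDE seat of the K4 Greenberg-1999 inputs; no claim).  THEOREMS ONLY (no definition, no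
named fact, no `sorry`); CASSELS (`Greenberg1999.casselsSurjectivity_H1Sigma ℚ`) and — in the `_of_poitouTate` forms —
the three generic Poitou–Tate rows over `ℚ` stay HYPOTHESES BY NAME.

The ♭ road's doors `SSFlatEC.flatCountTwo_of_print` / `…_of_clauses` / `…_of_localSurj` (seat `bsd-2adic-ss-1`,
parts 12–14) display, besides CASSELS and the single-place `♭`-local lift at `2`: Greenberg's Prop. 4.12 by name
(`prop412_noFiniteSubmodule_H1Sigma_of_rank_one`), a finitely generated Pontryagin-dual datum `(Y, dY)` of
`H¹(ℚ_Σ/ℚ_∞, E[2^∞])` with `rank_Λ Y = 1` (weak Leopoldt / Kato 12.4) and `Y[T]` finite or the p. 119 corank count.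
ALL of these served only the «DIV» half of Greenberg's chase (`sharpFlatEndCoinvariants_subsingleton_of_ambient …
hdiv hlift`).  The K4-inputs seat's level-`K` road (`SignedEC.PrimaryTorsionH2.forall_exists_conjH1_sub_eq_of_shaTwo_eq_bot`,
file `…ThetaPartnerAtTwoSignedControlAtTwoDivOfShaTwoAnyField`: Hochschild–Serre edge + `cd_2(ℤ₂) = 1` +
local `H²(ℚ_w, E[2^∞]) = 0`) gives «DIV» on the FULL group `H¹(ℚ_∞, E[2^∞])` from the ONE statement
`Ш²(ℚ, E[2^∞]) = 0`; the «LIFT′» half on the full group is assembled exactly as the K4 width seat did for `Sel⁺`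
(`SignedEC.ResTwo.exists_invariant_sub_mem_signedSelmerInfty_two`): every class is unramified outside a finite `S₀`
(AEU, `SignedEC.ResTwo.exists_finset_mem_unramifiedOutside`), the ♭ LIFT assembly
`exists_sub_resOfLe_mem_sharpFlatSelmerInfty_of_cassels_top` with that `S₀`, CASSELS by name, the local lifts at
`w ∤ p` from Greenberg p. 108 AS A THEOREM (`Greenberg1999.localQuotient_restriction_surjective_holds`,
`exists_localLift_of_localSurj`), and the displayed single-place `•`-local lift at the places above `p`.

* `exists_invariant_sub_mem_sharpFlatSelmerInfty_of_cassels_of_loc` — «LIFT′» on ALL of `H¹(ℚ_∞, E[p^∞])` for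
  `Sel^•` (any prime `p`, colour, `a_p`, local data; `κ` cyclotomic): CASSELS + `Sel_{p^∞}` finite +
  `#E(ℚ)[p^∞]^{Γ} = 1` + the `•`-local lift at the places above `p`;
* `sharpFlatEndCoinvariants_subsingleton_of_cassels_of_shaTwo` — `(Sel^•(E/ℚ_∞))_γ = 0` from the same plus
  `Ш²(ℚ, E[p^∞]) = 0`;
* `flatCountTwo_of_cassels_of_shaTwo` — **THE COUNT♭@2 DOOR re-keyed**: `GoodSS W 2`, `κ` cyclotomic, the two
  K3-shape `♭`-clauses, CASSELS by name, `Ш²(ℚ, E[2^∞]) = ⊥`, the `♭`-local lift at `2` ⟹ the COUNT♭@2 clause of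
  `stub_allFlatData` verbatim — NO Prop. 4.12, NO dual datum, NO rank / corank / weak-Leopoldt input, no `Σ₀`;
* `flatCountTwo_of_cassels_of_poitouTate`, `flatCountTwo_of_cassels_of_poitouTate_of_clauses` — the same with
  `Ш²(ℚ, E[2^∞]) = 0` DISCHARGED to the three generic Poitou–Tate rows over `ℚ` by name
  (`poitouTate_sha_tateDual ℚ`, `poitouTate_three_realPlaces_injective ℚ`, `poitouTate_two_realPlaces_surjective ℚ`;
  width seat w2's `SignedEC.ShaTwo.forall_mem_shaTwo_two_primary_eq_zero_of_goodSS`), the second on the line's own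
  Honda₂ clauses (GEN 10's derivation of the K3 shapes, as in `flatCountTwo_of_print_of_clauses`).

HONEST TAG of COUNT♭@2 after this file: by-name {CASSELS = Prop. 4.13, PT(a), 4.10(c)₃, 4.16 over `ℚ`} ∘ THEOREMS ∘
displayed {(LOC♭) at `2`}.  Nothing about any curve is asserted unconditionally; closes no item by itself; no summit
statement is proved by this seat; BSD is not proved by any of this.  References: [GreenbergLNM1716] §3 Lemma 3.3, §4
Lemma 4.7, pp. 104, 108, 119, 122; [MilneADT2006] I Thm. 4.10, Cor. 4.16, Thm. 6.13 (c); [Sprung2012] Lemma 2.3, Prop. 7.3.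
-/

set_option autoImplicit false
-- the Theorems namespace of this sub repeats the summit name by design (D-0017 nested layout)
set_option linter.dupNamespace false

noncomputable section

open scoped Classical NumberField

open NumberField IsDedekindDomain

namespace Summit.BirchSwinnertonDyer.BirchSwinnertonDyer.Theorems.SSFlatEC

open Literature.NumberTheory.EllipticCurves Literature.NumberTheory.GaloisRepresentations
  WeierstrassCurve ZpExtension Literature.NumberTheory.EllipticCurves.Kobayashi2003
  Literature.NumberTheory.EllipticCurves.Sprung2017 Literature.NumberTheory.EllipticCurves.Sprung2012
  Literature.NumberTheory.EllipticCurves.Sprung2024 Literature.NumberTheory.EllipticCurves.IwasawaDual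
  Literature.NumberTheory.EllipticCurves.IwasawaAlgebra Literature.NumberTheory.EllipticCurves.GreenbergVatsal2000
  Literature.NumberTheory.EllipticCurves.Rank1Residual Summit.BirchSwinnertonDyer.Rank1Residual.X5.O1
  Literature.NumberTheory.GaloisCohomology
open Summit.BirchSwinnertonDyer.Rank1Residual.X11b (LocBridge.primaryGaloisModule)
open Literature.NumberTheory.GaloisRepresentations.DiscreteGaloisModule (shaTwo)

/-! ## §1 «LIFT′» and `(Sel^•)_γ = 0` on ALL of `H¹(ℚ_∞, E[p^∞])` — any prime, colour and local data -/

section AnyPrime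

variable (W : WeierstrassCurve ℚ) [W.IsElliptic] {p : ℕ} [Fact p.Prime] (κ : ZpExtension ℚ p)
  {v₀ : HeightOneSpectrum (𝓞 ℚ)} (ap : ℤ) (g : Field.absoluteGaloisGroup (v₀.adicCompletion ℚ))
  (c : ℕ → localPoints W (v₀.adicCompletion ℚ)) (col : Chroma)

/-- **«LIFT′» for EVERY class of `H¹(ℚ_∞, E[p^∞])` and the Selmer group `Sel^•(E/ℚ_∞)`** (`κ` cyclotomic with
topological generator `γ`; CASSELS by name; `Sel_{p^∞}(E/ℚ)` finite; `#E(ℚ)[p^∞] = 1`; the `•`-local lift at the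
places above `p` displayed as `hlocp`): if `conj_γ t − t ∈ Sel^•` then `t − t₀ ∈ Sel^•` for a `conj_γ`-INVARIANT `t₀`
(`t₀ = res y`).  Proof = the K4 width seat's `SignedEC.ResTwo.exists_invariant_sub_mem_signedSelmerInfty_two` run for
`Sel^•`: all conjugates (`conjH1_sub_mem_of_conjH1_generator_sub_mem`), AEU
(`SignedEC.ResTwo.exists_finset_mem_unramifiedOutside`), the LIFT assembly
`exists_sub_resOfLe_mem_sharpFlatSelmerInfty_of_cassels_top` with that `S₀`, the local lifts at `w ∤ p` from
Greenberg p. 108 as a THEOREM (`Greenberg1999.localQuotient_restriction_surjective_holds`,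
`exists_localLift_of_localSurj`; `Sel^• ≤ Sel_∞ ≤ 𝒦_w`). [cite: GreenbergLNM1716, §3 Lemma 3.3 (p. 87), §4 Lemma 4.7
(pp. 107–108), p. 108, Prop. 4.13 / p. 122] -/
theorem exists_invariant_sub_mem_sharpFlatSelmerInfty_of_cassels_of_loc (hκ : κ.IsCyclotomic)
    {γ : Field.absoluteGaloisGroup ℚ} (hγ : κ.IsTopGenerator γ) (hv₀ : ((p : ℕ) : 𝓞 ℚ) ∈ v₀.asIdeal)
    (hC : Greenberg1999.casselsSurjectivity_H1Sigma ℚ) (hSel : Finite (W.selmerGroupPInfty p))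
    (hE : Nat.card (MulAction.fixedPoints (Field.absoluteGaloisGroup ℚ) (W.geomPrimaryTorsion p)) = 1)
    (hlocp : ∀ t : W.subgroupH1 p κ.kerSubgroup,
      (∀ σ : Field.absoluteGaloisGroup ℚ, W.conjH1 p κ.kerSubgroup σ t - t ∈
        sharpFlatSelmerInfty W κ (closureEmb (K := ℚ) (v₀.adicCompletion ℚ)) ap g c col) →
      ∀ w : HeightOneSpectrum (𝓞 ℚ), ((p : ℕ) : 𝓞 ℚ) ∈ w.asIdeal →
      ∃ xw : discreteH1 (localSubgroup (⊤ : Subgroup (Field.absoluteGaloisGroup ℚ)) (w.adicCompletion ℚ))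
          (localPoints W (w.adicCompletion ℚ)),
        (∃ k : ℕ, p ^ k • xw = 0) ∧
        ∀ y : W.subgroupH1 p (⊤ : Subgroup (Field.absoluteGaloisGroup ℚ)),
          W.localResOver p ⊤ (w.adicCompletion ℚ) y = xw →
          t - W.resOfLe p (le_top : κ.kerSubgroup ≤ ⊤) y ∈
              W.localKerOver p κ.kerSubgroup (w.adicCompletion ℚ) ∧
          (w = v₀ → t - W.resOfLe p (le_top : κ.kerSubgroup ≤ ⊤) y ∈
            sharpFlatLocalKummerOverOfEmb W p κ.kerSubgroup (closureEmb (K := ℚ) (v₀.adicCompletion ℚ))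
              (localTowerPointsOfEmb κ (closureEmb (K := ℚ) (v₀.adicCompletion ℚ)) W)
              (colemanKer κ (closureEmb (K := ℚ) (v₀.adicCompletion ℚ)) W ap g c col)))
    (t : W.subgroupH1 p κ.kerSubgroup)
    (ht : W.conjH1 p κ.kerSubgroup γ t - t ∈
      sharpFlatSelmerInfty W κ (closureEmb (K := ℚ) (v₀.adicCompletion ℚ)) ap g c col) :
    ∃ t₀ : W.subgroupH1 p κ.kerSubgroup, W.conjH1 p κ.kerSubgroup γ t₀ = t₀ ∧
      t - t₀ ∈ sharpFlatSelmerInfty W κ (closureEmb (K := ℚ) (v₀.adicCompletion ℚ)) ap g c col := by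
  -- all conjugates of `t` agree with `t` modulo `Sel^•`
  have htall : ∀ σ : Field.absoluteGaloisGroup ℚ, W.conjH1 p κ.kerSubgroup σ t - t ∈
      sharpFlatSelmerInfty W κ (closureEmb (K := ℚ) (v₀.adicCompletion ℚ)) ap g c col :=
    conjH1_sub_mem_of_conjH1_generator_sub_mem W κ hγ _
      (fun σ s hs ↦ conjH1_mem_sharpFlatSelmerInfty W κ _ ap g c col σ hs) ht
  -- AEU: `t` is unramified outside a finite `S₀ ⊇` the bad places prime to `p`
  obtain ⟨S₀, hgood, htH⟩ := SignedEC.ResTwo.exists_finset_mem_unramifiedOutside W p κ.kerSubgroup t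
  have hgood' : ∀ w : HeightOneSpectrum (𝓞 ℚ), w ∉ (↑S₀ : Set (HeightOneSpectrum (𝓞 ℚ))) →
      ((p : ℕ) : 𝓞 ℚ) ∉ w.asIdeal → W.HasGoodReductionAt w :=
    fun w hw hpw ↦ hgood w (fun h ↦ hw (Finset.mem_coe.mpr h)) hpw
  -- `Sel^• ≤ Sel_∞ ≤ 𝒦_w` at every finite `w`
  have hSelle : ∀ w : HeightOneSpectrum (𝓞 ℚ),
      sharpFlatSelmerInfty W κ (closureEmb (K := ℚ) (v₀.adicCompletion ℚ)) ap g c col ≤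
        W.localKerOver p κ.kerSubgroup (w.adicCompletion ℚ) := fun w s hs ↦ by
    have h1 := ((W.mem_selmerGroupOver_iff p κ.kerSubgroup s).1
      (sharpFlatSelmerInfty_le_selmerInfty W κ _ _ g c col hs)).1 w 1
    have hone : W.conjH1 p κ.kerSubgroup 1 = AddMonoidHom.id _ :=
      conjH1_of_mem_holds κ.kerSubgroup _ (one_mem _)
    rwa [hone, AddMonoidHom.id_apply] at h1
  -- the LIFT assembly with this `S₀`
  refine (exists_sub_resOfLe_mem_sharpFlatSelmerInfty_of_cassels_top W κ ap g c col hκ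
    (↑S₀ : Set (HeightOneSpectrum (𝓞 ℚ))) hgood' htH htall
    (fun x xi hx hxi ↦ hC W p hSel hE (↑S₀) S₀.finite_toSet hgood' x xi hx hxi) (fun w _ ↦ ?_) hv₀).elim
    fun y hy ↦ ⟨W.resOfLe p (le_top : κ.kerSubgroup ≤ ⊤) y, conjH1_resOfLe_top W κ γ y, hy⟩
  by_cases hpw : ((p : ℕ) : 𝓞 ℚ) ∈ w.asIdeal
  · -- `w ∣ p`: the displayed `•`-local lift
    exact hlocp t htall w hpw
  · -- `w ∤ p`: Greenberg p. 108 (theorem `localQuotient_restriction_surjective_holds`); `•`-clause vacuous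
    obtain ⟨xw, hx, hmain⟩ := exists_localLift_of_localSurj W κ
      (Greenberg1999.localQuotient_restriction_surjective_holds W p κ hκ w hpw) _ (hSelle w) t htall
    refine ⟨xw, hx, fun y hy' ↦ ⟨hmain y hy', fun hwv ↦ absurd ?_ hpw⟩⟩
    rw [hwv]
    exact hv₀

/-- **`(Sel^•(E/ℚ_∞))_γ = 0` from CASSELS, `Ш²(ℚ, E[p^∞]) = 0` and the `•`-local lift above `p`** (any prime `p`,
colour, `a_p`, local data; `κ` cyclotomic, `γ` a topological generator; `Sel_{p^∞}(E/ℚ)` finite, `#E(ℚ)[p^∞] = 1`):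
Greenberg's chase `sharpFlatEndCoinvariants_subsingleton_of_ambient` inside the FULL group `H¹(ℚ_∞, E[p^∞])`, with
«DIV» from `Ш² = 0` (`SignedEC.PrimaryTorsionH2.forall_exists_conjH1_sub_eq_of_shaTwo_eq_bot`: Hochschild–Serre, no
`Λ`-adic `H²`, no Prop. 4.12) and «LIFT′» from `exists_invariant_sub_mem_sharpFlatSelmerInfty_of_cassels_of_loc`.
[cite: GreenbergLNM1716, §4 pp. 104, 107–109, Prop. 4.12 (p. 119), p. 122] -/
theorem sharpFlatEndCoinvariants_subsingleton_of_cassels_of_shaTwo (hκ : κ.IsCyclotomic)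
    {γ : Field.absoluteGaloisGroup ℚ} (hγ : κ.IsTopGenerator γ) (hv₀ : ((p : ℕ) : 𝓞 ℚ) ∈ v₀.asIdeal)
    (hC : Greenberg1999.casselsSurjectivity_H1Sigma ℚ) (hSel : Finite (W.selmerGroupPInfty p))
    (hE : Nat.card (MulAction.fixedPoints (Field.absoluteGaloisGroup ℚ) (W.geomPrimaryTorsion p)) = 1)
    (hsha : shaTwo (LocBridge.primaryGaloisModule W p) = ⊥)
    (hlocp : ∀ t : W.subgroupH1 p κ.kerSubgroup,
      (∀ σ : Field.absoluteGaloisGroup ℚ, W.conjH1 p κ.kerSubgroup σ t - t ∈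
        sharpFlatSelmerInfty W κ (closureEmb (K := ℚ) (v₀.adicCompletion ℚ)) ap g c col) →
      ∀ w : HeightOneSpectrum (𝓞 ℚ), ((p : ℕ) : 𝓞 ℚ) ∈ w.asIdeal →
      ∃ xw : discreteH1 (localSubgroup (⊤ : Subgroup (Field.absoluteGaloisGroup ℚ)) (w.adicCompletion ℚ))
          (localPoints W (w.adicCompletion ℚ)),
        (∃ k : ℕ, p ^ k • xw = 0) ∧
        ∀ y : W.subgroupH1 p (⊤ : Subgroup (Field.absoluteGaloisGroup ℚ)),
          W.localResOver p ⊤ (w.adicCompletion ℚ) y = xw →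
          t - W.resOfLe p (le_top : κ.kerSubgroup ≤ ⊤) y ∈
              W.localKerOver p κ.kerSubgroup (w.adicCompletion ℚ) ∧
          (w = v₀ → t - W.resOfLe p (le_top : κ.kerSubgroup ≤ ⊤) y ∈
            sharpFlatLocalKummerOverOfEmb W p κ.kerSubgroup (closureEmb (K := ℚ) (v₀.adicCompletion ℚ))
              (localTowerPointsOfEmb κ (closureEmb (K := ℚ) (v₀.adicCompletion ℚ)) W)
              (colemanKer κ (closureEmb (K := ℚ) (v₀.adicCompletion ℚ)) W ap g c col))) :
    Subsingleton (EndCoinvariants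
      (conjSharpFlatSelmerInfty W κ (closureEmb (K := ℚ) (v₀.adicCompletion ℚ)) ap g c col γ - 1)) :=
  sharpFlatEndCoinvariants_subsingleton_of_ambient W κ (closureEmb (K := ℚ) (v₀.adicCompletion ℚ)) ap g c col γ ⊤
    (fun s _ ↦ by
      obtain ⟨t, ht⟩ := SignedEC.PrimaryTorsionH2.forall_exists_conjH1_sub_eq_of_shaTwo_eq_bot W p κ hγ hsha s
      exact ⟨t, AddSubgroup.mem_top t, ht⟩)
    (fun t _ ht ↦ exists_invariant_sub_mem_sharpFlatSelmerInfty_of_cassels_of_loc W κ ap g c col hκ hγ hv₀ hC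
      hSel hE hlocp t ht)

end AnyPrime

/-! ## §2 The COUNT♭@2 door re-keyed: CASSELS + `Ш²(ℚ, E[2^∞]) = 0` (or the three Poitou–Tate rows) + LOC♭@2 -/

section Two

variable (W : WeierstrassCurve ℚ) [W.IsElliptic] [W.IsGloballyMinimal]

/-- **THE COUNT♭@2 DOOR from CASSELS and `Ш²(ℚ, E[2^∞]) = 0`.** `W/ℚ` elliptic, globally minimal, good supersingular
at `2`; `κ` cyclotomic with topological generator `γ`; `v ∋ 2` with `♭`-data `(g, c)` satisfying the two K3-shape
clauses «`Ker Col♭` kills `E(ℚ₂)`» (`h𝒦`) and «`r₂` injective» (`hrp`); CASSELS by name; `Ш²(ℚ, E[2^∞]) = ⊥`; and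
(LOC♭) the single-place `♭`-local lift at the place(s) above `2` for every `t ∈ H¹(ℚ_∞, E[2^∞])` all of whose
`conj_σ t − t` lie in `Sel♭`.  Then the COUNT♭@2 clause of `stub_allFlatData` holds verbatim.  Compared with
`flatCountTwo_of_print{,_of_clauses,_of_localSurj}`: NO `prop412_noFiniteSubmodule_H1Sigma_of_rank_one`, NO dual datum
`(Y, dY, hbij, hT, hCY)`, NO `rank_Λ Y = 1` / `Y[T]` finite / corank count, NO `Σ₀` (`#E(ℚ)[2^∞] = 1` at good
supersingular `2`; Cassels' count `natCard_flatKerG_eq_pow_of_casselsSurjectivity`; §1).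
[cite: GreenbergLNM1716, §4 Prop. 4.13 / p. 122, p. 104, pp. 107–108, Prop. 4.12 (p. 119)]
[cite: Sprung2024, §5.2 Lemma 5.5 (p. 40)] -/
theorem flatCountTwo_of_cassels_of_shaTwo (hss : GoodSS W 2) (κ : ZpExtension ℚ 2) (hκ : κ.IsCyclotomic)
    {γ : Field.absoluteGaloisGroup ℚ} (hγ : κ.IsTopGenerator γ) {v : HeightOneSpectrum (𝓞 ℚ)}
    (hv : (2 : 𝓞 ℚ) ∈ v.asIdeal) (g : Field.absoluteGaloisGroup (v.adicCompletion ℚ))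
    (c : ℕ → localPoints W (v.adicCompletion ℚ))
    -- the two `♭`-clauses in the K3 shapes
    (h𝒦 : ∀ z ∈ colemanKer κ (closureEmb (K := ℚ) (v.adicCompletion ℚ)) W (W.frobeniusTrace 2) g c .flat,
      ∀ (x : localPoints W (v.adicCompletion ℚ))
        (hx : x ∈ localLayerPointsOfEmb κ (closureEmb (K := ℚ) (v.adicCompletion ℚ)) W 0),
        z ⟨x, localLayerPointsOfEmb_le_localTowerPointsOfEmb κ _ W 0 hx⟩ = 0)
    (hrp : ∀ y : W.subgroupH1 2 (κ.layerSubgroup 0),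
      W.layerToInfty κ 0 y ∈ sharpFlatLocalKummerOverOfEmb W 2 κ.kerSubgroup
          (closureEmb (K := ℚ) (v.adicCompletion ℚ))
          (localTowerPointsOfEmb κ (closureEmb (K := ℚ) (v.adicCompletion ℚ)) W)
          (colemanKer κ (closureEmb (K := ℚ) (v.adicCompletion ℚ)) W (W.frobeniusTrace 2) g c .flat) →
        y ∈ W.localKerOver 2 (κ.layerSubgroup 0) (v.adicCompletion ℚ))
    -- CASSELS by name, `Ш²(ℚ, E[2^∞]) = 0`
    (hC : Greenberg1999.casselsSurjectivity_H1Sigma ℚ)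
    (hsha : shaTwo (LocBridge.primaryGaloisModule W 2) = ⊥)
    -- (LOC♭): the single-place `♭`-local lift at the place(s) above `2`
    (hloc2 : ∀ t : W.subgroupH1 2 κ.kerSubgroup,
      (∀ σ : Field.absoluteGaloisGroup ℚ, W.conjH1 2 κ.kerSubgroup σ t - t ∈
        sharpFlatSelmerInfty W κ (closureEmb (K := ℚ) (v.adicCompletion ℚ)) (W.frobeniusTrace 2) g c .flat) →
      ∀ w : HeightOneSpectrum (𝓞 ℚ), ((2 : ℕ) : 𝓞 ℚ) ∈ w.asIdeal →
      ∃ xw : discreteH1 (localSubgroup (⊤ : Subgroup (Field.absoluteGaloisGroup ℚ)) (w.adicCompletion ℚ))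
          (localPoints W (w.adicCompletion ℚ)),
        (∃ k : ℕ, 2 ^ k • xw = 0) ∧
        ∀ y : W.subgroupH1 2 (⊤ : Subgroup (Field.absoluteGaloisGroup ℚ)),
          W.localResOver 2 ⊤ (w.adicCompletion ℚ) y = xw →
          t - W.resOfLe 2 (le_top : κ.kerSubgroup ≤ ⊤) y ∈
              W.localKerOver 2 κ.kerSubgroup (w.adicCompletion ℚ) ∧
          (w = v → t - W.resOfLe 2 (le_top : κ.kerSubgroup ≤ ⊤) y ∈
            sharpFlatLocalKummerOverOfEmb W 2 κ.kerSubgroup (closureEmb (K := ℚ) (v.adicCompletion ℚ))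
              (localTowerPointsOfEmb κ (closureEmb (K := ℚ) (v.adicCompletion ℚ)) W)
              (colemanKer κ (closureEmb (K := ℚ) (v.adicCompletion ℚ)) W (W.frobeniusTrace 2) g c .flat))) :
    Finite (W.selmerGroupPInfty 2) →
      Finite (EndCoinvariants (conjSharpFlatSelmerInfty W κ (closureEmb (K := ℚ) (v.adicCompletion ℚ))
        (W.frobeniusTrace 2) g c .flat γ - 1)) →
      Nat.card (↥((sharpFlatSelmerInfty W κ (closureEmb (K := ℚ) (v.adicCompletion ℚ))
            (W.frobeniusTrace 2) g c .flat).comap (W.layerToInfty κ 0)) ⧸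
          (W.selmerLayer κ 0).addSubgroupOf
            ((sharpFlatSelmerInfty W κ (closureEmb (K := ℚ) (v.adicCompletion ℚ))
              (W.frobeniusTrace 2) g c .flat).comap (W.layerToInfty κ 0))) *
        Nat.card (MulAction.fixedPoints (Field.absoluteGaloisGroup ℚ) (W.geomPrimaryTorsion 2)) =
      2 ^ (padicValNat 2 W.tamagawaProduct) *
        Nat.card (EndCoinvariants (conjSharpFlatSelmerInfty W κ
          (closureEmb (K := ℚ) (v.adicCompletion ℚ)) (W.frobeniusTrace 2) g c .flat γ - 1)) := by
  -- `#E(ℚ)[2^∞] = 1` at a good supersingular `2`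
  have hirr := (irr_two_iff_forall_two_nsmul W).mp
    (Summit.BirchSwinnertonDyer.Rank1Residual.P2.irr_two_of_goodSS_two W hss)
  have htors : Nat.card (MulAction.fixedPoints (Field.absoluteGaloisGroup ℚ) (W.geomPrimaryTorsion 2)) = 1 := by
    refine W.natCard_fixedPoints_absoluteGaloisGroup_geomPrimaryTorsion_eq_one (p := 2) fun P hP ↦ ?_
    apply hirr P
    convert hP
  -- good reduction at the place `v ∋ 2`
  have hv' : ((2 : ℕ) : 𝓞 ℚ) ∈ v.asIdeal := by exact_mod_cast hv
  have hgoodv : W.HasGoodReductionAt v :=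
    (hasGoodReductionAtPrime_primesEquiv_iff_holds W v 2
      (Literature.NumberTheory.GaloisRepresentations.LocalField.primesEquiv_eq_of_natCast_mem 2 v hv')).mp hss.1
  refine flatCountTwo_of_cassels_of_coinv W hss κ γ g c (fun hSel ↦ ?_) (fun hSel _ ↦ ?_)
  · -- Cassels' count, by name
    exact natCard_flatKerG_eq_pow_of_casselsSurjectivity W κ (W.frobeniusTrace 2) g c .flat hC hκ hv' hgoodv
      h𝒦 hrp hSel htors
  · -- COINV♭ from CASSELS + `Ш² = 0` + LOC♭@2 (§1)
    haveI := sharpFlatEndCoinvariants_subsingleton_of_cassels_of_shaTwo W κ (W.frobeniusTrace 2) g c .flat hκ hγ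
      hv' hC hSel htors hsha hloc2
    exact Nat.card_unique

/-- **THE COUNT♭@2 DOOR from CASSELS and the three generic Poitou–Tate rows over `ℚ`** — as
`flatCountTwo_of_cassels_of_shaTwo` with `Ш²(ℚ, E[2^∞]) = 0` DISCHARGED (under `Sel_{2^∞}(E/ℚ)` finite, `GoodSS W 2`)
to `poitouTate_sha_tateDual ℚ` (Milne I 4.10 (a)), `poitouTate_three_realPlaces_injective ℚ` (4.10 (c), `r = 3`),
`poitouTate_two_realPlaces_surjective ℚ` (Cor. 4.16), by the width seat's
`SignedEC.ShaTwo.forall_mem_shaTwo_two_primary_eq_zero_of_goodSS`.  HONEST TAG: by-name {CASSELS, PT(a), 4.10(c)₃,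
4.16}(ℚ) ∘ THEOREMS ∘ displayed {(LOC♭) at `2`}. [cite: GreenbergLNM1716, §4 Prop. 4.13 / p. 122, Prop. 4.12 (p. 119)]
[cite: MilneADT2006, Ch. I, Thm. 4.10 (a),(c), Cor. 4.16, Thm. 6.13 (c)] -/
theorem flatCountTwo_of_cassels_of_poitouTate (hss : GoodSS W 2) (κ : ZpExtension ℚ 2) (hκ : κ.IsCyclotomic)
    {γ : Field.absoluteGaloisGroup ℚ} (hγ : κ.IsTopGenerator γ) {v : HeightOneSpectrum (𝓞 ℚ)}
    (hv : (2 : 𝓞 ℚ) ∈ v.asIdeal) (g : Field.absoluteGaloisGroup (v.adicCompletion ℚ))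
    (c : ℕ → localPoints W (v.adicCompletion ℚ))
    (h𝒦 : ∀ z ∈ colemanKer κ (closureEmb (K := ℚ) (v.adicCompletion ℚ)) W (W.frobeniusTrace 2) g c .flat,
      ∀ (x : localPoints W (v.adicCompletion ℚ))
        (hx : x ∈ localLayerPointsOfEmb κ (closureEmb (K := ℚ) (v.adicCompletion ℚ)) W 0),
        z ⟨x, localLayerPointsOfEmb_le_localTowerPointsOfEmb κ _ W 0 hx⟩ = 0)
    (hrp : ∀ y : W.subgroupH1 2 (κ.layerSubgroup 0),
      W.layerToInfty κ 0 y ∈ sharpFlatLocalKummerOverOfEmb W 2 κ.kerSubgroup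
          (closureEmb (K := ℚ) (v.adicCompletion ℚ))
          (localTowerPointsOfEmb κ (closureEmb (K := ℚ) (v.adicCompletion ℚ)) W)
          (colemanKer κ (closureEmb (K := ℚ) (v.adicCompletion ℚ)) W (W.frobeniusTrace 2) g c .flat) →
        y ∈ W.localKerOver 2 (κ.layerSubgroup 0) (v.adicCompletion ℚ))
    -- by name: CASSELS and the three Poitou–Tate rows over `ℚ`
    (hC : Greenberg1999.casselsSurjectivity_H1Sigma ℚ) (hPT : poitouTate_sha_tateDual ℚ)
    (h3 : poitouTate_three_realPlaces_injective ℚ) (h2 : poitouTate_two_realPlaces_surjective ℚ)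
    (hloc2 : ∀ t : W.subgroupH1 2 κ.kerSubgroup,
      (∀ σ : Field.absoluteGaloisGroup ℚ, W.conjH1 2 κ.kerSubgroup σ t - t ∈
        sharpFlatSelmerInfty W κ (closureEmb (K := ℚ) (v.adicCompletion ℚ)) (W.frobeniusTrace 2) g c .flat) →
      ∀ w : HeightOneSpectrum (𝓞 ℚ), ((2 : ℕ) : 𝓞 ℚ) ∈ w.asIdeal →
      ∃ xw : discreteH1 (localSubgroup (⊤ : Subgroup (Field.absoluteGaloisGroup ℚ)) (w.adicCompletion ℚ))
          (localPoints W (w.adicCompletion ℚ)),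
        (∃ k : ℕ, 2 ^ k • xw = 0) ∧
        ∀ y : W.subgroupH1 2 (⊤ : Subgroup (Field.absoluteGaloisGroup ℚ)),
          W.localResOver 2 ⊤ (w.adicCompletion ℚ) y = xw →
          t - W.resOfLe 2 (le_top : κ.kerSubgroup ≤ ⊤) y ∈
              W.localKerOver 2 κ.kerSubgroup (w.adicCompletion ℚ) ∧
          (w = v → t - W.resOfLe 2 (le_top : κ.kerSubgroup ≤ ⊤) y ∈
            sharpFlatLocalKummerOverOfEmb W 2 κ.kerSubgroup (closureEmb (K := ℚ) (v.adicCompletion ℚ))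
              (localTowerPointsOfEmb κ (closureEmb (K := ℚ) (v.adicCompletion ℚ)) W)
              (colemanKer κ (closureEmb (K := ℚ) (v.adicCompletion ℚ)) W (W.frobeniusTrace 2) g c .flat))) :
    Finite (W.selmerGroupPInfty 2) →
      Finite (EndCoinvariants (conjSharpFlatSelmerInfty W κ (closureEmb (K := ℚ) (v.adicCompletion ℚ))
        (W.frobeniusTrace 2) g c .flat γ - 1)) →
      Nat.card (↥((sharpFlatSelmerInfty W κ (closureEmb (K := ℚ) (v.adicCompletion ℚ))
            (W.frobeniusTrace 2) g c .flat).comap (W.layerToInfty κ 0)) ⧸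
          (W.selmerLayer κ 0).addSubgroupOf
            ((sharpFlatSelmerInfty W κ (closureEmb (K := ℚ) (v.adicCompletion ℚ))
              (W.frobeniusTrace 2) g c .flat).comap (W.layerToInfty κ 0))) *
        Nat.card (MulAction.fixedPoints (Field.absoluteGaloisGroup ℚ) (W.geomPrimaryTorsion 2)) =
      2 ^ (padicValNat 2 W.tamagawaProduct) *
        Nat.card (EndCoinvariants (conjSharpFlatSelmerInfty W κ
          (closureEmb (K := ℚ) (v.adicCompletion ℚ)) (W.frobeniusTrace 2) g c .flat γ - 1)) := fun hSel ↦ by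
  haveI := hSel
  have hsha : shaTwo (LocBridge.primaryGaloisModule W 2) = ⊥ := by
    rw [eq_bot_iff]
    intro z hz
    rw [AddSubgroup.mem_bot]
    exact SignedEC.ShaTwo.forall_mem_shaTwo_two_primary_eq_zero_of_goodSS W hss hPT h3 h2 z hz
  exact flatCountTwo_of_cassels_of_shaTwo W hss κ hκ hγ hv g c h𝒦 hrp hC hsha hloc2 hSel

/-- **THE DOOR on the line's own Honda₂ clauses** — as `flatCountTwo_of_cassels_of_poitouTate`, with the two K3-shape
`♭`-clauses DERIVED from the Honda₂ clauses of `stub_allFlatData` exactly as in `flatCountTwo_of_print_of_clauses`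
(GEN 10: `apply_layer_zero_eq_zero_of_mem_colemanKer_flat`, `mem_localKerOver_of_flat_rat`, Lemma 2.3 at `2`
`eq_zero_of_mem_localTowerPointsOfEmb_of_two_nsmul`).  So on the line the displayed residue of COUNT♭@2 is EXACTLY
{(LOC♭) at `2`} + by name {CASSELS, PT(a), 4.10(c)₃, 4.16 over `ℚ`} — no Greenberg Prop. 4.12, no Kato 12.4.
[cite: GreenbergLNM1716, §4 Prop. 4.13 / p. 122, p. 104, pp. 107–108] [cite: Sprung2012, Thm. 2.2, Lemma 2.3, Prop. 7.3]
[cite: MilneADT2006, Ch. I, Thm. 4.10 (a),(c), Cor. 4.16] -/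
theorem flatCountTwo_of_cassels_of_poitouTate_of_clauses (hss : GoodSS W 2) (κ : ZpExtension ℚ 2)
    (hκ : κ.IsCyclotomic) {γ : Field.absoluteGaloisGroup ℚ} (hγ : κ.IsTopGenerator γ)
    {v : HeightOneSpectrum (𝓞 ℚ)} (hv : (2 : 𝓞 ℚ) ∈ v.asIdeal)
    {g : Field.absoluteGaloisGroup (v.adicCompletion ℚ)} {c : ℕ → localPoints W (v.adicCompletion ℚ)}
    -- the Honda₂ clauses of the line
    (hg : κ.IsTopGenerator (resGalOfEmb (closureEmb (K := ℚ) (v.adicCompletion ℚ)) g))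
    (hc : ∀ n, c n ∈ localLayerPointsOfEmb κ (closureEmb (K := ℚ) (v.adicCompletion ℚ)) W n)
    (hTr : ∀ n, 1 ≤ n → localTraceOfEmb κ (closureEmb (K := ℚ) (v.adicCompletion ℚ)) W n (n + 1)
      (c (n + 1)) = W.frobeniusTrace 2 • c n - c (n - 1))
    (hinj : ∀ z₀ : localLayerPointsOfEmb κ (closureEmb (K := ℚ) (v.adicCompletion ℚ)) W 0 →+ ℤ_[2],
      evalOn W (localLayerPointsOfEmb κ (closureEmb (K := ℚ) (v.adicCompletion ℚ)) W 0) z₀ (c 0) = 0 →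
        z₀ = 0)
    (hsat : ∀ a : ℤ_[2],
      (∃ z₀ : localLayerPointsOfEmb κ (closureEmb (K := ℚ) (v.adicCompletion ℚ)) W 0 →+ ℤ_[2],
        evalOn W (localLayerPointsOfEmb κ (closureEmb (K := ℚ) (v.adicCompletion ℚ)) W 0) z₀ (c 0) =
          2 * a) →
      ∃ y : localLayerPointsOfEmb κ (closureEmb (K := ℚ) (v.adicCompletion ℚ)) W 0 →+ ℤ_[2],
        evalOn W (localLayerPointsOfEmb κ (closureEmb (K := ℚ) (v.adicCompletion ℚ)) W 0) y (c 0) = a)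
    -- by name: CASSELS and the three Poitou–Tate rows over `ℚ`
    (hC : Greenberg1999.casselsSurjectivity_H1Sigma ℚ) (hPT : poitouTate_sha_tateDual ℚ)
    (h3 : poitouTate_three_realPlaces_injective ℚ) (h2 : poitouTate_two_realPlaces_surjective ℚ)
    -- (LOC♭) at `2`
    (hloc2 : ∀ t : W.subgroupH1 2 κ.kerSubgroup,
      (∀ σ : Field.absoluteGaloisGroup ℚ, W.conjH1 2 κ.kerSubgroup σ t - t ∈
        sharpFlatSelmerInfty W κ (closureEmb (K := ℚ) (v.adicCompletion ℚ)) (W.frobeniusTrace 2) g c .flat) →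
      ∀ w : HeightOneSpectrum (𝓞 ℚ), ((2 : ℕ) : 𝓞 ℚ) ∈ w.asIdeal →
      ∃ xw : discreteH1 (localSubgroup (⊤ : Subgroup (Field.absoluteGaloisGroup ℚ)) (w.adicCompletion ℚ))
          (localPoints W (w.adicCompletion ℚ)),
        (∃ k : ℕ, 2 ^ k • xw = 0) ∧
        ∀ y : W.subgroupH1 2 (⊤ : Subgroup (Field.absoluteGaloisGroup ℚ)),
          W.localResOver 2 ⊤ (w.adicCompletion ℚ) y = xw →
          t - W.resOfLe 2 (le_top : κ.kerSubgroup ≤ ⊤) y ∈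
              W.localKerOver 2 κ.kerSubgroup (w.adicCompletion ℚ) ∧
          (w = v → t - W.resOfLe 2 (le_top : κ.kerSubgroup ≤ ⊤) y ∈
            sharpFlatLocalKummerOverOfEmb W 2 κ.kerSubgroup (closureEmb (K := ℚ) (v.adicCompletion ℚ))
              (localTowerPointsOfEmb κ (closureEmb (K := ℚ) (v.adicCompletion ℚ)) W)
              (colemanKer κ (closureEmb (K := ℚ) (v.adicCompletion ℚ)) W (W.frobeniusTrace 2) g c .flat))) :
    Finite (W.selmerGroupPInfty 2) →
      Finite (EndCoinvariants (conjSharpFlatSelmerInfty W κ (closureEmb (K := ℚ) (v.adicCompletion ℚ))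
        (W.frobeniusTrace 2) g c .flat γ - 1)) →
      Nat.card (↥((sharpFlatSelmerInfty W κ (closureEmb (K := ℚ) (v.adicCompletion ℚ))
            (W.frobeniusTrace 2) g c .flat).comap (W.layerToInfty κ 0)) ⧸
          (W.selmerLayer κ 0).addSubgroupOf
            ((sharpFlatSelmerInfty W κ (closureEmb (K := ℚ) (v.adicCompletion ℚ))
              (W.frobeniusTrace 2) g c .flat).comap (W.layerToInfty κ 0))) *
        Nat.card (MulAction.fixedPoints (Field.absoluteGaloisGroup ℚ) (W.geomPrimaryTorsion 2)) =
      2 ^ (padicValNat 2 W.tamagawaProduct) *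
        Nat.card (EndCoinvariants (conjSharpFlatSelmerInfty W κ
          (closureEmb (K := ℚ) (v.adicCompletion ℚ)) (W.frobeniusTrace 2) g c .flat γ - 1)) := by
  -- Lemma 2.3 at `2` (tree theorem, GEN 10)
  have hnt : ∀ P ∈ localTowerPointsOfEmb κ (closureEmb (K := ℚ) (v.adicCompletion ℚ)) W, 2 • P = 0 → P = 0 :=
    fun P hP hP2 ↦ eq_zero_of_mem_localTowerPointsOfEmb_of_two_nsmul W hss κ hv _ hP hP2
  refine flatCountTwo_of_cassels_of_poitouTate W hss κ hκ hγ hv g c (fun z hz x hx ↦ ?_) (fun y hy ↦ ?_)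
    hC hPT h3 h2 hloc2
  · exact apply_layer_zero_eq_zero_of_mem_colemanKer_flat (hc 0) hinj hz hx
  · exact mem_localKerOver_of_flat_rat W 2 κ hv hnt hss.2 hg hc hTr hinj hsat y hy

end Two

end Summit.BirchSwinnertonDyer.BirchSwinnertonDyer.Theorems.SSFlatEC

end
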